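import Literature.AlgebraicGeometry.HodgeTheory.LefschetzOneOneChowClosed
import Literature.NumberTheory.Transcendental.AnalytificationConnected
import Literature.AlgebraicGeometry.Motives.Varieties
import HarnessLib

/-!
# Projective manifolds — smoothness of the algebraisation, part (I): a scheme analytified by a connected manifold is irreducible

Support file of the algebraisation package `Literature.AlgebraicGeometry.Motives.ProjectiveManifold`
(re-homed verbatim from `Summits/HodgeConjecture/HodgeConjecture/Theorems/SecondaryPeriodsRiemannWeightOneStubAlgebraisationSmoothIrreducible.lean`,
route `SecondaryPeriods`, crux `RiemannWeightOne`, where it was first proved; Literature cannot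
import Summits; `connectedSpace_of_isAnalytification` is added). Helper file for
`ProjectiveManifold.isSmoothProjective_of_isAnalytification` (Serre, GAGA
§2 n°6–8: the reduced closed subscheme `X ⊆ ℙᴺ_ℂ` analytified by a compact connected complex
manifold `M` through an injective holomorphic immersion is smooth projective of dimension `dim M`).

This file proves the TOPOLOGICAL third of that statement:

* `irreducibleSpace_of_isAnalytification` — **a `ℂ`-scheme locally of finite type analytified by
  a CONNECTED complex manifold is irreducible.** If `X = Z₁ ∪ Z₂` with `Zᵢ` closed and neither
  equal to `X`, the open `X ∖ Z₂ ⊆ Z₁` is non-empty, hence contains a closed point, i.e. a complex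
  point (`X` is Jacobson); so the analytic subset `φ⁻¹(Z₁(ℂ))` of `M` (Serre, GAGA §2 n°5 Lemme 1:
  Zariski-closed sets are analytic, the tree's `isAnalyticSet_preimage_setOf_pt_mem`) has non-empty
  interior, hence is all of `M` by the identity theorem for analytic subsets of a connected manifold
  (`IsAnalyticSet.interior_eq_empty_holds`); then every closed point of `X` lies on `Z₁`, and
  `Z₁ = X` (closed points are dense) — a contradiction.
* `isIntegral_of_isAnalytification` — hence such an `X`, if reduced, is integral.
* `isProjectiveOver_of_hom` — bookkeeping for a closed subscheme `ι : X ↪ ℙᴺ_ℂ` (properness,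
  hence finite type, of such an `X` is the tree's `Motives.LinearSectionNet.isProper_hom` pattern
  `rw [← Over.w ι]; infer_instance`).

## References

* [SerreGAGA1956] J.-P. Serre, Géométrie algébrique et géométrie analytique, Ann. Inst. Fourier 6
  (1956), §2 n°5 Lemme 1 b), n°7 Prop. 5.
* [SGA1] A. Grothendieck, M. Raynaud, SGA 1, Exp. XII Prop. 2.1, Prop. 2.4.
* [Chirka1989] E. M. Chirka, Complex Analytic Sets (1989), §2.2 Prop. 1.
-/

noncomputable section


namespace Literature.AlgebraicGeometry.Motives.ProjectiveManifold

open scoped Manifold ContDiff _root_.Topology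
open CategoryTheory _root_.AlgebraicGeometry TopologicalSpace
open Literature.AlgebraicGeometry.Motives
open Literature.NumberTheory.Transcendental (IsAnalytification)
open Literature.Geometry.Kaehler (IsAnalyticSet)

/-! ### Closed subschemes of projective space: bookkeeping -/

section Projective

variable {N : ℕ} {X : SchemeOver ℂ} (ι : X ⟶ projectiveSpace N ℂ) [IsClosedImmersion ι.left]

include ι in
/-- A closed subscheme of `ℙᴺ_ℂ` is projective over `ℂ` (by definition). [folklore] -/
private theorem isProjectiveOver_of_hom : IsProjectiveOver X := ⟨N, ι, inferInstance⟩

end Projective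

/-! ### Irreducibility from a connected analytification -/

section Irreducible

variable {X : SchemeOver ℂ} {n d : ℕ} {M : Type*} [TopologicalSpace M]
  [ChartedSpace (Fin n → ℂ) M] {φ : M → ComplexPoints X}

/-- **The preimage of a proper Zariski-closed subset under a connected analytification has empty
interior**, i.e. if `φ⁻¹(Z(ℂ))` has an interior point then `Z ⊇` all closed points, so `Z = X`.
(GAGA §2 n°5 Lemme 1 b: `φ⁻¹(Z(ℂ))` is analytic; identity theorem for analytic subsets of the
connected manifold `M`; closed points of the Jacobson scheme `X` are complex points and are dense.)
[cite: SerreGAGA1956, §2 n°5 Lemme 1 b)] [cite: Chirka1989, §2.2 Prop. 1] -/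
theorem eq_univ_of_interior_preimage_nonempty [LocallyOfFiniteType X.hom] [ConnectedSpace M]
    [IsManifold 𝓘(ℂ, Fin n → ℂ) ω M] (hφ : IsAnalytification (Fin n → ℂ) X d φ)
    {Z : Set X.left} (hZ : IsClosed Z)
    (hint : (interior (φ ⁻¹' {P : ComplexPoints X | P.pt ∈ Z})).Nonempty) : Z = Set.univ := by
  haveI : IsManifold 𝓘(ℂ, Fin n → ℂ) 1 M := IsManifold.of_le (n := ω) le_top
  have hAn : IsAnalyticSet 𝓘(ℂ, Fin n → ℂ) (φ ⁻¹' {P : ComplexPoints X | P.pt ∈ Z}) :=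
    Literature.AlgebraicGeometry.HodgeTheory.isAnalyticSet_preimage_setOf_pt_mem hφ hZ
  -- the analytic set `φ⁻¹(Z(ℂ))` has non-empty interior, hence is everything
  have hall : φ ⁻¹' {P : ComplexPoints X | P.pt ∈ Z} = Set.univ := by
    by_contra hne
    have h0 := Literature.Geometry.Kaehler.IsAnalyticSet.interior_eq_empty_holds 𝓘(ℂ, Fin n → ℂ) M
      hAn hne
    rw [h0] at hint
    exact Set.not_nonempty_empty hint
  -- so every complex point, i.e. every closed point, lies on `Z`
  haveI := ComplexPoints.jacobsonSpace_left (X := X)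
  have hcl : closedPoints X.left ⊆ Z := by
    rw [← ComplexPoints.range_pt]
    rintro _ ⟨P, rfl⟩
    obtain ⟨m, rfl⟩ := hφ.isHomeomorph.surjective P
    have hm : m ∈ φ ⁻¹' {P : ComplexPoints X | P.pt ∈ Z} := by rw [hall]; trivial
    exact hm
  -- and the closed points are dense
  have h := closure_mono hcl
  rw [closure_closedPoints, hZ.closure_eq] at h
  exact Set.eq_univ_of_univ_subset h

/-- **A `ℂ`-scheme locally of finite type analytified by a connected complex manifold is
irreducible** (the topological part of Serre's «`X` irréductible ⇔ `X^h` irréductible», here only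
`⇐` and only for a manifold `X^h`): if `X = Z₁ ∪ Z₂` with `Zᵢ` closed and `Z₁ ≠ X`, then
`X ∖ Z₁ ⊆ Z₂` is a non-empty open, so it carries a complex point, `φ⁻¹(Z₂(ℂ))` has an interior
point, and `Z₂ = X` (`eq_univ_of_interior_preimage_nonempty`). Non-emptiness: `M` is connected,
hence non-empty. [cite: SerreGAGA1956, §2 n°5 Lemme 1 b) and n°7 Prop. 5] [cite: SGA1, Exp. XII Prop. 2.1 and Prop. 2.4] -/
theorem irreducibleSpace_of_isAnalytification [LocallyOfFiniteType X.hom] [ConnectedSpace M]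
    [IsManifold 𝓘(ℂ, Fin n → ℂ) ω M] (hφ : IsAnalytification (Fin n → ℂ) X d φ) :
    IrreducibleSpace X.left := by
  classical
  -- non-empty
  obtain ⟨m₀⟩ := (inferInstance : Nonempty M)
  haveI : Nonempty X.left := ⟨(φ m₀).pt⟩
  rw [irreducibleSpace_def]
  refine ⟨Set.univ_nonempty, (isPreirreducible_iff_isClosed_union_isClosed
    (s := (Set.univ : Set X.left))).2 fun Z₁ Z₂ hZ₁ hZ₂ hcov => ?_⟩
  by_contra hnot
  rw [not_or] at hnot
  obtain ⟨h₁, h₂⟩ := hnot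
  -- `X ∖ Z₁` is a non-empty open inside `Z₂`
  have hne : (Z₁ᶜ : Set X.left).Nonempty := by
    by_contra h
    rw [Set.not_nonempty_iff_eq_empty, Set.compl_empty_iff] at h
    exact h₁ (h ▸ le_rfl)
  have hsub : Z₁ᶜ ⊆ Z₂ := fun x hx => (hcov (Set.mem_univ x)).resolve_left hx
  -- a complex point on it
  obtain ⟨P, hP⟩ := ComplexPoints.exists_pt_mem (X := X) hne hZ₁.isOpen_compl.isLocallyClosed
  -- the open `φ⁻¹((X ∖ Z₁)(ℂ)) ∋ φ⁻¹ P` lies in `φ⁻¹(Z₂(ℂ))`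
  have hopen : IsOpen (φ ⁻¹' {Q : ComplexPoints X | Q.pt ∈ (⟨Z₁ᶜ, hZ₁.isOpen_compl⟩ : X.left.Opens)}) :=
    hφ.isOpen_preimage ⟨Z₁ᶜ, hZ₁.isOpen_compl⟩
  obtain ⟨m, rfl⟩ := hφ.isHomeomorph.surjective P
  have hint : (interior (φ ⁻¹' {Q : ComplexPoints X | Q.pt ∈ Z₂})).Nonempty := by
    refine ⟨m, interior_maximal (fun m' hm' => ?_) hopen hP⟩
    exact hsub hm'
  have hZ₂univ := eq_univ_of_interior_preimage_nonempty hφ hZ₂ hint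
  exact h₂ (hZ₂univ ▸ le_rfl)

/-- **Reduced + connected manifold analytification ⇒ integral.** [cite: SerreGAGA1956, §2 n°5 Lemme 1 b) and n°7 Prop. 5] -/
theorem isIntegral_of_isAnalytification [LocallyOfFiniteType X.hom] [ConnectedSpace M]
    [IsManifold 𝓘(ℂ, Fin n → ℂ) ω M] [IsReduced X.left]
    (hφ : IsAnalytification (Fin n → ℂ) X d φ) : IsIntegral X.left :=
  haveI := irreducibleSpace_of_isAnalytification hφ
  isIntegral_of_irreducibleSpace_of_isReduced X.left

/-- The space of complex points of a scheme analytified by a connected space is connected (`φ` is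
a homeomorphism `M ≃ X(ℂ)`). [cite: SerreGAGA1956, §2 (définition de X^h)] -/
theorem connectedSpace_complexPoints_of_isAnalytification [ConnectedSpace M]
    (hφ : IsAnalytification (Fin n → ℂ) X d φ) : ConnectedSpace (ComplexPoints X) :=
  hφ.isHomeomorph.surjective.connectedSpace hφ.isHomeomorph.continuous

/-- The space of complex points of a scheme analytified by a compact space is compact.
[folklore] -/
private theorem compactSpace_complexPoints_of_isAnalytification [CompactSpace M]
    (hφ : IsAnalytification (Fin n → ℂ) X d φ) : CompactSpace (ComplexPoints X) :=
  hφ.homeomorph.compactSpace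

/-- **A `ℂ`-scheme locally of finite type analytified by a connected complex manifold is
CONNECTED** (as a scheme: its Zariski space is connected), being irreducible
(`irreducibleSpace_of_isAnalytification`). [cite: SerreGAGA1956, §2 n°5 Lemme 1 b) and n°7 Prop. 5] -/
theorem connectedSpace_of_isAnalytification [LocallyOfFiniteType X.hom] [ConnectedSpace M]
    [IsManifold 𝓘(ℂ, Fin n → ℂ) ω M] (hφ : IsAnalytification (Fin n → ℂ) X d φ) :
    ConnectedSpace X.left :=
  haveI := irreducibleSpace_of_isAnalytification hφ
  inferInstance

end Irreducible

end Literature.AlgebraicGeometry.Motives.ProjectiveManifold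

end
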